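import Literature.MathematicalPhysics.QuantumFieldTheory.Balaban1983to89.B9SupplySockB9P3Zd
import Literature.MathematicalPhysics.QuantumFieldTheory.Balaban1983to89.B9Ineq3137LocalSup
import Literature.MathematicalPhysics.QuantumFieldTheory.Balaban1983to89.B8CubeMemberZd
import Literature.MathematicalPhysics.QuantumFieldTheory.Balaban1983to89.B8LambdaSpaceKLevel

/-!
# `Balaban1983to89.B9SupplySockB9P3ZdLettersOmega` — THE LOCATED REPAIR OF THE J-N06→N05 JUNCTION'S LETTERS:
# [Balaban1985BackgroundPropagators] (3.27) READ AS PRINTED — `G(U) = (Δ_a↾Ω₀)⁻¹`, `Δ_a↾Ω₀ = Ω₀Δ_aΩ₀` (Dirichlet on the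
# BONDS OF Ω₀) — the field class `E(Ω₀)`, the four operator binders of B8 p. 86 on it, and the OUTER-COLLAR CALCULUS of the
# `ℤᵈ` carrier (what a bond field supported on the sides of the corner plaquettes of a finite `Ω₀` contributes to (1.59))

statement-level skeleton of published theorems with citation tags; proofs where landed; nothing here is a claim about the
Yang–Mills mass gap

PDF held: `paper:balaban1985-cmp99-background-propagators` ([4] = B9; journal page = PDF page + 388): p. 394–395 (3.20)–(3.27)
(«The operator Δ_a↾Ω₀ … Dirichlet boundary conditions on ∂Ω₀, i.e. the operator Δ′_a↾Ω₀ = Ω₀Δ′_aΩ₀. In the last expression Ω₀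
denotes a characteristic function of Ω₀ … thus Δ_a↾Ω₀ = Ω₀Δ_aΩ₀, and we denote its inverse again by G, or G(U) … G(U) = G =
(Δ_a↾Ω₀)⁻¹ (3.27)»), p. 397 (3.41), p. 398 (3.47), p. 399 Thm 3.3, p. 404 (3.69); `paper:balaban1985-cmp99-regular-spaces-gauge-fixing`
(B8; journal page = PDF page + 74): p. 77 («If Ω ⊂ T_η, then we denote by Ω also the set of bonds … at least one end-point of b
belongs to Ω.  Similarly for the corresponding set of plaquettes»), p. 86 (1.55)–(1.59), p. 98–99 (1.131)–(1.133).  Read by this seat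
on the held text layers (2026-08-27).

WHY THIS FILE (cell `pub-ymgap`, seat `pub-ymgap-dag-n06-b` g5, junction J-N06→N05; count-neutral).  The g4 junction
`B9SupplySockB9P3Zd.sockB9P3_allLevels_of_thm33` (B8 p. 86 «Theorem 3.3 of [4] implies the bounds (1.59)», kernel-checked modulo the
operator-letter binders of `B9SupplySockB9P3ZdLetters`) was certified VACUOUS: `B8JunctionH59Vacuity.junction_hypotheses_unsatisfiable`
(dag-n05-e g5) — its hypothesis set is jointly unsatisfiable for EVERY frame, because the family `ZdIdx d L` contains finite-`Ω₀`
members (the cube member `{□_j}` of (1.131)) at which the letters' field class `OnE` (bond fields supported on the SIDES OF THE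
PLAQUETTES TOUCHING `Ω_j` — the consumer's reading of «on Ω_j», strictly larger than print's «bonds with an end-point in Ω_j» at a
finite `Ω₀`) makes the left-inverse binder `InvOnSupp` («G(U₀)∘Δ_a(U₀) = id on E») claim too much: print's `G(U) = (Ω₀Δ_aΩ₀)⁻¹`
inverts `Δ_a` only on fields supported on the bonds OF `Ω₀`; the pure-gauge mode sitting on the two outer sides of a corner plaquette
of `Ω₀` is in `OnE`, is invisible to `|J|₍₋₃₎` and `|B₁|`, and (3.47) then forces it to vanish.  THIS FILE is the located repair on
the supplier's side: the field class and the binders re-typed on print's Dirichlet domain (§§1–2), and the elementary lattice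
calculus (§3) that bounds what the OUTER part `A′ − 𝟙_{Ω₀}A′` of a socket datum contributes to the four local lines of (1.59) —
by the level-0 collar functional `Φ₀(A′) = sup_{b ∈ collar} η‖A′(b)‖` that dag-n05-e's repaired sockets (`B8LeafModelZd3Bdry`,
`B8Prop6CubeMemberNormsBdry`, located repair R-d) carry on their right-hand sides — under the MARGIN hypothesis `Margin2` (the
ℓ∞-2-neighbourhood of every `Ω_j`, `j ≥ 1`, lies in `Ω₀`; §4: the cube families of (1.131) have it, margin `R₁M₁ ≥ L ≥ 2`).  The junction
theorems themselves are the companion file `B9SupplySockB9P3ZdOmega`.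

WHAT IS DECLARED ∕ PROVED.
* §1 (definitions) `OnDom` — print's class E(Ω₀): bond fields vanishing off the bonds with an end-point in `Ω₀` (`B8Ineq132.BondTouches`),
  with the bounded weighted family of the consumer's norm; `restrictDom Ω₀ A = 𝟙_{Ω₀-bonds}·A`, `outerPart Ω₀ A = A − 𝟙_{Ω₀-bonds}·A`;
  `Margin2 Ω`.
* §2 (definitions) the binders of B8 p. 86 on E(Ω₀): `InvOnDom` ((3.27): for `A ∈ E(Ω₀)` and any `J` agreeing with `Δ_a(U₀)A` on the
  Ω₀-bonds, `G(U₀)J = A` — the letter reads the Ω₀-bonds only, as `Ω₀Δ_aΩ₀` does), `CurvSmallDom` ((3.69)), `LandauKillsDom`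
  ((3.20)–(3.21) with (1.42)), `AvgBoundDom` ((3.16) with (1.56)) — the g4 binders VERBATIM with `OnE ↦ OnDom`.
* §3 (theorems, kernel) the outer-collar calculus: linearity and ℓ∞-locality of `∇^η_{U₀}`, `J = D^{η*}_{U₀}D^η_{U₀}`, `Δ^η_{U₀}`
  (`covDerivFwd`, `Jcur`, `covLap`); under `Margin2` every outer interaction sits at level `0`; the four collar estimates
  `msup_side_le_restrict_add` (line 1: `+ Φ₀`), `msup_grad_le_restrict_add` (line 2: `+ 2Φ₀`), `bondNorm_jcur_restrict_le` (`|J(𝟙_{Ω₀}A′)|₍₋₃₎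
  ≤ |J(A′)|₍₋₃₎ + 16d·Φ₀`), `bondNorm_covLap_le_restrict_add` (line 4: `+ 4d·Φ₀`); the Landau condition and the averaging functional
  `|B₁|` do not see the outer part (`isLandau138_restrictDom_iff`, `wsupB1_restrictDom`).
* §4 `margin2_cubeFam` (the family `{□_j}_{j=0}^{k}` of (1.131)∕(1.132) with `R₁M₁ ≥ 2`), `margin2_of_univ` (`Ω₀ = ℤᵈ`).

HONEST SCOPE.  (i) LETTERS, NOT OBJECTS (as in g4): `OpsZd` is a parameter; the binders are what B8 p. 86 uses of [4] Sect. A, now typed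
on the domain on which print's operators act; proving them at the carrier = constructing [4] Sect. A there (N06's object-bound, NOT
here).  (ii) SATISFIABILITY: by print's objects at every member at which [4] Sect. A + Thm 3.11 hold (not claimed); the certified
refutation mechanism of the g4 letters (outer pure-gauge modes) is excluded from E(Ω₀) by definition; at members with an EMPTY
averaging set (`Λb ≡ ∅`, ref-A J2′) `AvgBoundDom` + `InvOnDom` are — correctly — uninhabitable (print's `Δ_a` is not invertible
there): consumers quantify over law-abiding members (dag-n05-c `B8IdxB8LawsB`).  (iii) `Φ₀`, `Margin2` and the collar term are the
TREE's bookkeeping of exterior data (print's A′ lives on the Ω₀-bonds only, B8 p. 77; its Prop.-6 application of Thm 4 at the finite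
cube family (1.132) has `U₀″ ≠ 1` on `□̃ ∖ □₀`, whence dag-n05-e's R-d).  (iv) Count-neutral; N05∕N06 NOT discharged; one finite
lattice programme; nothing continuum ∕ ℝ⁴ ∕ OS ∕ mass-gap ∕ Clay.  Unit `pub-ymgap-dag-n06-b` (g5), 2026-08-27.
-/

noncomputable section

open NormedSpace

namespace Literature.MathematicalPhysics.QuantumFieldTheory.Balaban1983to89.B9SupplySockB9P3ZdLettersOmega

open Complex (I)
open B7Prop1Explicit (U1 e)
open B7Prop1Local (InBox AgreeOn loK bondHiK)
open B7Prop2Explicit (unitaryUnits unitaryUnits_le_U1)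
open B7Prop4GeneralLevels (linCovIter)
open B7Eq78Linearization (conjR)
open B8Ineq132 (covDerivFwd covDeriv InAk BondTouches PlaqTouches)
open B8Eq140Level (SideTouches IsSide)
open B8Eq146AExpansion (iEta plaqCovDeriv)
open B8Eq143PlaqExpansion (pdiv)
open B8Eq155JBound (Jcur wsup)
open B8ScaledSupNorm (bondNorm msup weight Bdd)
open B8Eq138LandauZd (IsLandau138 covDivB covLap)
open B8LeafModelZd (ZdIdx)
open B8Eq131CubesAdmissible (cubeFam)
open B9SupplySockB9P3ZdLetters (OpsZd deltaAOf)

-- `Site` alone could resolve to the torus sites of `Setup.lean`; re-export the `ℤ^d` sites of `B7Prop1Explicit`.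
export B7Prop1Explicit (Site)

variable {d : ℕ}

/-! ## §1 Print's field class E(Ω₀), the restriction to the Ω₀-bonds, the margin predicate -/

section Classes

variable {𝔸 : Type*} [CStarAlgebra 𝔸]

/-- **THE FIELD CLASS E(Ω₀) OF [4] SECT. A** («fields on Ω₀» — B8 p. 77: «we denote by Ω also the set of bonds … at least one end-point
of b belongs to Ω»; [4] p. 394–395: `Δ_a↾Ω₀ = Ω₀Δ_aΩ₀`, `Ω₀` the characteristic function — Dirichlet boundary conditions on `∂Ω₀`): on the
`ℤᵈ` carrier with `m` levels, `A` VANISHES OFF THE BONDS WITH AN END-POINT IN `Ω₀` (`B8Ineq132.BondTouches`) and its `(Lʲη)`-weighted family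
over the consumer's collar index set (sides of the plaquettes touching `Ω_j`, `j ≤ m`) is bounded (r05's `Bdd`: the real supremum `|A|₍₋₁₎` is
attained).  The located repair of g4's `OnE` (support on the SIDES of the plaquettes touching `Ω_j`, strictly larger at a finite `Ω₀`).
[cite: Balaban1985BackgroundPropagators, (3.27) p.395, (3.41) p.397; Balaban1985RegularSpaces, p.77 (bond convention), (1.41) p.83] -/
def OnDom (L m : ℕ) (η : ℝ) (Ω : ℕ → Set (Site d)) (A : Site d → Fin d → 𝔸) : Prop :=
  (∀ (y : Site d) (τ : Fin d), ¬ BondTouches (Ω 0) y τ → A y τ = 0) ∧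
    Bdd L m η (-(1 : ℝ)) (fun j (b : Site d × Fin d) => SideTouches (Ω j) b.1 b.2) (fun b => A b.1 b.2)

open Classical in
/-- **`𝟙_{Ω₀}·A`** — the restriction of a bond field to the bonds with an end-point in `Ω₀` (the characteristic function `Ω₀` of
[4] p. 394 acting on bond fields, B8 p. 77 bond convention). [cite: Balaban1985BackgroundPropagators, (3.27) p.395; Balaban1985RegularSpaces, p.77 (bond convention)] -/
def restrictDom (Ω₀ : Set (Site d)) (A : Site d → Fin d → 𝔸) : Site d → Fin d → 𝔸 :=
  fun y τ => if BondTouches Ω₀ y τ then A y τ else 0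

open Classical in
/-- **`A − 𝟙_{Ω₀}·A`** — the OUTER part of a bond field: its values on the bonds with NO end-point in `Ω₀` (for a socket datum these
are the outer sides of the corner plaquettes of `Ω₀`, the tree's exterior data; print's A′ has no such part).
[cite: Balaban1985RegularSpaces, p.77 (bond convention), (1.133) p.99; Balaban1985BackgroundPropagators, (3.27) p.395] -/
def outerPart (Ω₀ : Set (Site d)) (A : Site d → Fin d → 𝔸) : Site d → Fin d → 𝔸 :=
  fun y τ => if BondTouches Ω₀ y τ then 0 else A y τ

/-- **THE MARGIN PREDICATE**: for every `j ≥ 1` the ℓ∞-`2`-neighbourhood of `Ω_j` lies in `Ω₀` — so that every bond read by `∇^η`,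
`D^{η*}D^η`, `Δ^η` at a bond of `Ω_j`, `j ≥ 1`, or at a side of a plaquette touching `Ω_j`, is a bond of `Ω₀` (the cube families of
(1.131) have margins `R₁M₁Lʲ⁻¹ ≥ L`, §4).  The tree's hypothesis under which the exterior data of a finite `Ω₀` interacts with (1.59) at
level `0` only. [cite: Balaban1985RegularSpaces, p.98 («a distance between boundaries of these cubes is equal to R₁M₁Lʲη»), (1.131) p.99] -/
def Margin2 (Ω : ℕ → Set (Site d)) : Prop :=
  ∀ j, 1 ≤ j → ∀ v ∈ Ω j, ∀ y : Site d, (∀ i, v i - 2 ≤ y i ∧ y i ≤ v i + 2) → y ∈ Ω 0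

end Classes

/-! ## §2 The binders of B8 p. 86 on E(Ω₀) -/

section Binders

variable {𝔸 : Type*} [CStarAlgebra 𝔸]
variable {I : Type} (bg : I → B9.Backgrounds)
variable (L : ℕ) (mem : ℝ → ZdIdx d L → ℕ → I)
variable (ιCfg : ∀ (M : ℝ) (i : ZdIdx d L) (m : ℕ) (U₀ : Site d → Fin d → 𝔸ˣ),
  (∀ x κ, U₀ x κ ∈ unitaryUnits 𝔸) → (bg (mem M i m)).Cfg)

/-- **(3.27) AS PRINTED, IN THE FORM B8 (1.58) USES IT**: «Δ_a↾Ω₀ = Ω₀Δ_aΩ₀, and we denote its inverse again by G, or G(U) … G(U) = G =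
(Δ_a↾Ω₀)⁻¹» — for a regular background (the member's (3.35) class at `α₀`, `M ≥ M₃`, `Mα₀ ≤ a₃`: Theorem 3.11's regime, where `Δ_a` is
positive definite on the fields on `Ω₀`), every `A ∈ E(Ω₀)` (`OnDom`) and every bond field `J` AGREEING WITH `Δ_a(U₀)A` ON THE BONDS OF
`Ω₀`: `G(U₀)J = A`.  (The letter `Gop U₀` reads the Ω₀-bonds of its argument only and returns fields on `Ω₀`, as `(Ω₀Δ_aΩ₀)⁻¹Ω₀` does;
print's `G` at a member with empty averaging set does not exist — there the binder is uninhabitable, correctly.)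
[cite: Balaban1985BackgroundPropagators, (3.27) p.395, (3.26) p.395, Thm 3.11 p.416; Balaban1985RegularSpaces, (1.58) p.86] -/
def InvOnDom (ops : ℝ → ZdIdx d L → ℕ → OpsZd d 𝔸) (c35 M₃ a₃ : ℝ) : Prop :=
  ∀ (M : ℝ) (i : ZdIdx d L) (m : ℕ), M₃ ≤ M →
    ∀ (α₀ : ℝ) (U₀ : Site d → Fin d → 𝔸ˣ) (hU₀ : ∀ x κ, U₀ x κ ∈ unitaryUnits 𝔸), 0 < α₀ → M * α₀ ≤ a₃ →
      (bg (mem M i m)).Reg335 c35 α₀ (ιCfg M i m U₀ hU₀) →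
      ∀ A : Site d → Fin d → 𝔸, OnDom L m i.η i.Ω A →
        ∀ J : Site d → Fin d → 𝔸, (∀ (y : Site d) (τ : Fin d), BondTouches (i.Ω 0) y τ → J y τ = deltaAOf i.η (ops M i m) U₀ A y τ) →
          (ops M i m).Gop U₀ J = A

/-- **(3.69) AT U′ = 1 IN THE WEIGHTED NORMS (3.41)**, on E(Ω₀) — g4's `CurvSmall` VERBATIM with the field class `OnE ↦ OnDom`: for a regular
background in Theorem 3.11's regime and `A ∈ E(Ω₀)`, POINTWISE on the bonds of `Ω_j`, `j ≤ m`, `(Lʲη)³|(Δ′(U₀)A)(b)| ≤ c₆₉·M·α₀·|A|₍₋₁₎`.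
[cite: Balaban1985BackgroundPropagators, (3.69) p.404, (3.10) p.392, (3.41) p.397] -/
def CurvSmallDom (ops : ℝ → ZdIdx d L → ℕ → OpsZd d 𝔸) (c35 M₃ a₃ c69 : ℝ) : Prop :=
  ∀ (M : ℝ) (i : ZdIdx d L) (m : ℕ), M₃ ≤ M →
    ∀ (α₀ : ℝ) (U₀ : Site d → Fin d → 𝔸ˣ) (hU₀ : ∀ x κ, U₀ x κ ∈ unitaryUnits 𝔸), 0 < α₀ → M * α₀ ≤ a₃ →
      (bg (mem M i m)).Reg335 c35 α₀ (ιCfg M i m U₀ hU₀) →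
      ∀ A : Site d → Fin d → 𝔸, OnDom L m i.η i.Ω A → ∀ j, j ≤ m → ∀ (x : Site d) (μ : Fin d), BondTouches (i.Ω j) x μ →
        ((L : ℝ) ^ j * i.η) ^ 3 * ‖(ops M i m).Dp U₀ A x μ‖ ≤
          c69 * M * α₀ * msup L m i.η (-(1 : ℝ)) (fun j (b : Site d × Fin d) => SideTouches (i.Ω j) b.1 b.2) (fun b => A b.1 b.2)

/-- **THE LANDAU CONDITION KILLS THE DRD\* TERM**, on E(Ω₀) — g4's `LandauKills` VERBATIM with `OnE ↦ OnDom` ((3.20)–(3.21) with B8 (1.42): for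
`R(U₀)D^{η*}_{U₀}A = 0` the equation for `A` has no `DRD*` term; the Landau condition of record `B8Eq138LandauZd.IsLandau138` reads `A` on the
bonds of `Ω₀` only, `isLandau138_congr`). [cite: Balaban1985BackgroundPropagators, (3.20)–(3.21) p.394, (3.25) p.394; Balaban1985RegularSpaces, (1.42) p.83, (1.58) p.86] -/
def LandauKillsDom (ops : ℝ → ZdIdx d L → ℕ → OpsZd d 𝔸) (c35 M₃ a₃ : ℝ) : Prop :=
  ∀ (M : ℝ) (i : ZdIdx d L) (m : ℕ), M₃ ≤ M →
    ∀ (α₀ : ℝ) (U₀ : Site d → Fin d → 𝔸ˣ) (hU₀ : ∀ x κ, U₀ x κ ∈ unitaryUnits 𝔸), 0 < α₀ → M * α₀ ≤ a₃ →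
      (bg (mem M i m)).Reg335 c35 α₀ (ιCfg M i m U₀ hU₀) →
      ∀ A : Site d → Fin d → 𝔸, OnDom L m i.η i.Ω A → IsLandau138 L m i.η (i.Ω 0) (i.Λs m) U₀ A →
        ∀ (x : Site d) (μ : Fin d), (ops M i m).DRDs U₀ A x μ = 0

/-- **THE AVERAGING TERM IS BOUNDED BY |B₁|**, on E(Ω₀) — g4's `AvgBound` VERBATIM with `OnE ↦ OnDom` ((3.16) with B8 (1.56)∕(1.58): POINTWISE on
the bonds of `Ω_j`, `(Lʲη)³|(Σ_j(Lʲη)⁻²Q*_jΛ_jQ_jA)(b)| ≤ q·|B₁(A)|`, `|B₁(A)|` the consumer's weighted supremum of `LʲηQ_j(U₀)A` over the averaging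
bonds `Λb m`). [cite: Balaban1985BackgroundPropagators, (3.16) p.393; Balaban1985RegularSpaces, (1.56), (1.58) p.86] -/
def AvgBoundDom (ops : ℝ → ZdIdx d L → ℕ → OpsZd d 𝔸) (q : ℝ) : Prop :=
  ∀ (M : ℝ) (i : ZdIdx d L) (m : ℕ) (U₀ : Site d → Fin d → 𝔸ˣ), (∀ x κ, U₀ x κ ∈ unitaryUnits 𝔸) →
    ∀ A : Site d → Fin d → 𝔸, OnDom L m i.η i.Ω A → ∀ j, j ≤ m → ∀ (x : Site d) (μ : Fin d), BondTouches (i.Ω j) x μ →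
      ((L : ℝ) ^ j * i.η) ^ 3 * ‖(ops M i m).QQ U₀ A x μ‖ ≤
        q * wsup 1 (fun p : {p : ℕ × (Site d × Fin d) // p.1 ≤ m ∧ p.2 ∈ i.Λb m p.1} =>
              linCovIter L U₀ (iEta i.η A) p.1.1 p.1.2.1 p.1.2.2)

end Binders

/-! ## §3 The outer-collar calculus of the `ℤᵈ` carrier -/

section Calculus

variable {𝔸 : Type*} [CStarAlgebra 𝔸]

/-! ### §3.1 Restriction and outer part -/

/-- On a bond of `Ω₀`, `𝟙_{Ω₀}A = A`. [cite: Balaban1985RegularSpaces, p.77 (bond convention)] -/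
theorem restrictDom_of {Ω₀ : Set (Site d)} (A : Site d → Fin d → 𝔸) {y : Site d} {τ : Fin d} (h : BondTouches Ω₀ y τ) :
    restrictDom Ω₀ A y τ = A y τ := by
  simp [restrictDom, h]

/-- Off the bonds of `Ω₀`, `𝟙_{Ω₀}A = 0`. [cite: Balaban1985RegularSpaces, p.77 (bond convention)] -/
theorem restrictDom_of_not {Ω₀ : Set (Site d)} (A : Site d → Fin d → 𝔸) {y : Site d} {τ : Fin d} (h : ¬ BondTouches Ω₀ y τ) :
    restrictDom Ω₀ A y τ = 0 := by
  simp [restrictDom, h]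

/-- On a bond of `Ω₀` the outer part vanishes. [cite: Balaban1985RegularSpaces, p.77 (bond convention)] -/
theorem outerPart_of {Ω₀ : Set (Site d)} (A : Site d → Fin d → 𝔸) {y : Site d} {τ : Fin d} (h : BondTouches Ω₀ y τ) :
    outerPart Ω₀ A y τ = 0 := by
  simp [outerPart, h]

/-- Off the bonds of `Ω₀` the outer part is the field. [cite: Balaban1985RegularSpaces, p.77 (bond convention)] -/
theorem outerPart_of_not {Ω₀ : Set (Site d)} (A : Site d → Fin d → 𝔸) {y : Site d} {τ : Fin d} (h : ¬ BondTouches Ω₀ y τ) :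
    outerPart Ω₀ A y τ = A y τ := by
  simp [outerPart, h]

/-- `A = 𝟙_{Ω₀}A + (A − 𝟙_{Ω₀}A)`. [cite: Balaban1985RegularSpaces, p.77 (bond convention)] -/
theorem restrictDom_add_outerPart (Ω₀ : Set (Site d)) (A : Site d → Fin d → 𝔸) :
    restrictDom Ω₀ A + outerPart Ω₀ A = A := by
  funext y τ
  by_cases h : BondTouches Ω₀ y τ <;> simp [restrictDom, outerPart, h]

/-- Componentwise form of `A = 𝟙_{Ω₀}A + (A − 𝟙_{Ω₀}A)` for the `τ`-component as a site function. [cite: Balaban1985RegularSpaces, p.77 (bond convention)] -/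
theorem restrictDom_add_outerPart_comp (Ω₀ : Set (Site d)) (A : Site d → Fin d → 𝔸) (τ : Fin d) :
    ((fun z => restrictDom Ω₀ A z τ) + fun z => outerPart Ω₀ A z τ) = fun z => A z τ := by
  funext z
  have h := congrFun (congrFun (restrictDom_add_outerPart Ω₀ A) z) τ
  simpa using h

/-- `‖𝟙_{Ω₀}A(b)‖ ≤ ‖A(b)‖`. [cite: Balaban1985RegularSpaces, p.77 (bond convention)] -/
theorem norm_restrictDom_le (Ω₀ : Set (Site d)) (A : Site d → Fin d → 𝔸) (y : Site d) (τ : Fin d) :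
    ‖restrictDom Ω₀ A y τ‖ ≤ ‖A y τ‖ := by
  by_cases h : BondTouches Ω₀ y τ <;> simp [restrictDom, h]

/-- `‖(A − 𝟙_{Ω₀}A)(b)‖ ≤ ‖A(b)‖`. [cite: Balaban1985RegularSpaces, p.77 (bond convention)] -/
theorem norm_outerPart_le (Ω₀ : Set (Site d)) (A : Site d → Fin d → 𝔸) (y : Site d) (τ : Fin d) :
    ‖outerPart Ω₀ A y τ‖ ≤ ‖A y τ‖ := by
  by_cases h : BondTouches Ω₀ y τ <;> simp [outerPart, h]

/-! ### §3.2 Linearity of `∇^η_{U₀}`, `D^η_{U₀}`, `J = D^{η*}_{U₀}D^η_{U₀}`, `D^{η*}_{U₀}`, `Δ^η_{U₀}` in the field -/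

/-- The covariant plaquette derivative (3.4) is additive in the bond field. [cite: Balaban1985BackgroundPropagators, (3.4) p.391] -/
theorem plaqCovDeriv_add (η : ℝ) (U₀ : Site d → Fin d → 𝔸ˣ) (A B : Site d → Fin d → 𝔸) (μ ν : Fin d) (x : Site d) :
    plaqCovDeriv η U₀ (A + B) μ ν x = plaqCovDeriv η U₀ A μ ν x + plaqCovDeriv η U₀ B μ ν x := by
  simp only [B8Eq146AExpansion.plaqCovDeriv_eq_covDerivFwd]
  have h1 : (fun y => (A + B) y ν) = (fun y => A y ν) + fun y => B y ν := rfl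
  have h2 : (fun y => (A + B) y μ) = (fun y => A y μ) + fun y => B y μ := rfl
  rw [h1, h2, B8LambdaSpaceKLevel.covDerivFwd_add', B8LambdaSpaceKLevel.covDerivFwd_add']
  abel

/-- **B8's current `J = D^{η*}_{U₀}D^η_{U₀}A` (1.55) is additive in `A`.** [cite: Balaban1985RegularSpaces, (1.55) p.86] -/
theorem Jcur_add (η : ℝ) (U₀ : Site d → Fin d → 𝔸ˣ) (A B : Site d → Fin d → 𝔸) (μ : Fin d) (x : Site d) :
    Jcur η U₀ (A + B) μ x = Jcur η U₀ A μ x + Jcur η U₀ B μ x := by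
  rw [B8Eq155JBound.Jcur_def, B8Eq155JBound.Jcur_def, B8Eq155JBound.Jcur_def]
  have h : plaqCovDeriv η U₀ (A + B) = plaqCovDeriv η U₀ A + plaqCovDeriv η U₀ B := by
    funext μ' ν' x'
    exact plaqCovDeriv_add η U₀ A B μ' ν' x'
  rw [h, B8Eq143PlaqExpansion.pdiv_add]

/-- The covariant divergence (1.1)₂ is additive in the bond field. [cite: Balaban1985RegularSpaces, (1.1) p.76] -/
theorem covDivB_add (η : ℝ) (U₀ : Site d → Fin d → 𝔸ˣ) (A B : Site d → Fin d → 𝔸) (x : Site d) :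
    covDivB η U₀ (A + B) x = covDivB η U₀ A x + covDivB η U₀ B x := by
  simp only [covDivB, ← Finset.sum_add_distrib]
  refine Finset.sum_congr rfl fun μ _ => ?_
  have h : (fun z => (A + B) z μ) = (fun z => A z μ) + fun z => B z μ := rfl
  rw [h, B8Eq143PlaqExpansion.covDeriv_add]

/-- **The covariant Laplacian `Δ^η_{U₀}` (3.23) is additive.** [cite: Balaban1985BackgroundPropagators, (3.23) p.394] -/
theorem covLap_add (η : ℝ) (U₀ : Site d → Fin d → 𝔸ˣ) (f g : Site d → 𝔸) (x : Site d) :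
    covLap η U₀ (f + g) x = covLap η U₀ f x + covLap η U₀ g x := by
  unfold covLap
  have h : (fun z μ => covDerivFwd η U₀ μ (f + g) z) =
      (fun z μ => covDerivFwd η U₀ μ f z) + fun z μ => covDerivFwd η U₀ μ g z := by
    funext z μ
    exact B8LambdaSpaceKLevel.covDerivFwd_add' η U₀ μ f g z
  rw [h, covDivB_add]

/-! ### §3.3 Pointwise bounds for `U1`-valued backgrounds -/

section U1Bounds

variable [Nontrivial 𝔸]

/-- `‖(∇^η_{V,κ}f)(x)‖ ≤ η⁻¹(‖f(x + e_κ)‖ + ‖f(x)‖)` (`|R(u)X| = |X|` for `u ∈ U1`). [cite: Balaban1985RegularSpaces, (1.1) p.76] -/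
theorem norm_covDerivFwd_le {η : ℝ} (hη : 0 < η) {V : Site d → Fin d → 𝔸ˣ} {κ : Fin d} {x : Site d} (hV : V x κ ∈ U1 𝔸)
    (f : Site d → 𝔸) : ‖covDerivFwd η V κ f x‖ ≤ η⁻¹ * (‖f (x + e κ)‖ + ‖f x‖) := by
  unfold covDerivFwd
  rw [norm_smul, norm_inv, Real.norm_eq_abs, abs_of_pos hη]
  refine mul_le_mul_of_nonneg_left ?_ (inv_nonneg.mpr hη.le)
  exact (norm_sub_le _ _).trans (add_le_add (B8Ineq132.norm_conjR_le hV _) le_rfl)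

/-- `‖(D^{η*}_V B)(x)‖ ≤ 2d·η⁻¹·G` for a bond field with `‖B‖ ≤ G` and a `U1`-valued background. [cite: Balaban1985RegularSpaces, (1.1) p.76] -/
theorem norm_covDivB_le {η : ℝ} (hη : 0 < η) {V : Site d → Fin d → 𝔸ˣ} (hV : ∀ y κ, V y κ ∈ U1 𝔸) {B : Site d → Fin d → 𝔸} {G : ℝ}
    (hG : ∀ (y : Site d) (μ : Fin d), ‖B y μ‖ ≤ G) (x : Site d) : ‖covDivB η V B x‖ ≤ 2 * d * (η⁻¹ * G) := by
  unfold covDivB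
  have hterm : ∀ μ : Fin d, ‖covDeriv η V μ (fun z => B z μ) x‖ ≤ 2 * (η⁻¹ * G) := fun μ => by
    refine (B8Eq143PlaqExpansion.norm_covDeriv_le hη (hV _ _) _).trans ?_
    have := hG (x - e μ) μ
    have := hG x μ
    nlinarith [inv_nonneg.mpr hη.le]
  calc ‖∑ μ : Fin d, covDeriv η V μ (fun z => B z μ) x‖ ≤ ∑ μ : Fin d, 2 * (η⁻¹ * G) := norm_sum_le_of_le _ fun μ _ => hterm μ
    _ = 2 * d * (η⁻¹ * G) := by rw [Finset.sum_const, Finset.card_univ, Fintype.card_fin, nsmul_eq_mul]; ring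

/-- `‖(Δ^η_V f)(x)‖ ≤ 4d·η⁻²·s` for a site function with `‖f‖ ≤ s` and a `U1`-valued background. [cite: Balaban1985BackgroundPropagators, (3.23) p.394] -/
theorem norm_covLap_le {η : ℝ} (hη : 0 < η) {V : Site d → Fin d → 𝔸ˣ} (hV : ∀ y κ, V y κ ∈ U1 𝔸) {f : Site d → 𝔸} {s : ℝ}
    (hs : ∀ y : Site d, ‖f y‖ ≤ s) (x : Site d) : ‖covLap η V f x‖ ≤ 4 * d * (η⁻¹ * (η⁻¹ * s)) := by
  unfold covLap
  have hB : ∀ (y : Site d) (μ : Fin d), ‖covDerivFwd η V μ f y‖ ≤ η⁻¹ * (2 * s) := fun y μ =>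
    (norm_covDerivFwd_le hη (hV y μ) f).trans (mul_le_mul_of_nonneg_left (by linarith [hs (y + e μ), hs y]) (inv_nonneg.mpr hη.le))
  refine (norm_covDivB_le hη hV hB x).trans_eq ?_
  ring

end U1Bounds

/-! ### §3.4 ℓ∞-locality of `∇^η`, `J`, `Δ^η` -/

/-- `(∇^η_{V,κ}f)(x)` reads `f` at `x` and `x + e_κ` only. [cite: Balaban1985RegularSpaces, (1.1) p.76] -/
theorem covDerivFwd_congr_pt {η : ℝ} {V : Site d → Fin d → 𝔸ˣ} {κ : Fin d} {f g : Site d → 𝔸} {x : Site d} (h0 : f x = g x)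
    (h1 : f (x + e κ) = g (x + e κ)) : covDerivFwd η V κ f x = covDerivFwd η V κ g x := by
  simp only [covDerivFwd, h0, h1]

omit [CStarAlgebra 𝔸] in
/-- The sites `x`, `x ± e_ν`, `x + e_ν`, `x − e_ν + e_κ` lie in the ℓ∞-unit ball of `x`. [folklore] -/
private theorem near_pts (x : Site d) (ν κ : Fin d) :
    (∀ i, x i - 1 ≤ x i ∧ x i ≤ x i + 1) ∧ (∀ i, x i - 1 ≤ (x + e ν) i ∧ (x + e ν) i ≤ x i + 1) ∧
      (∀ i, x i - 1 ≤ (x - e ν) i ∧ (x - e ν) i ≤ x i + 1) ∧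
      (∀ i, x i - 1 ≤ (x - e ν + e κ) i ∧ (x - e ν + e κ) i ≤ x i + 1) := by
  refine ⟨fun i => ⟨by linarith, by linarith⟩, fun i => ?_, fun i => ?_, fun i => ?_⟩ <;>
    simp only [Pi.add_apply, Pi.sub_apply, B7Prop1Explicit.e_apply] <;> split_ifs <;> omega

/-- **ℓ∞-LOCALITY OF B8's CURRENT**: `J_μ(x) = (D^{η*}_{U₀}D^η_{U₀}A)_μ(x)` reads `A` only on bonds `⟨y, y + e_τ⟩` whose base point `y` lies
in the ℓ∞-unit ball of `x` (the sides of the plaquettes containing `⟨x, x + e_μ⟩`). [cite: Balaban1985RegularSpaces, (1.55) p.86, (1.1)–(1.2) p.76] -/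
theorem Jcur_congr_ball {η : ℝ} {U₀ : Site d → Fin d → 𝔸ˣ} {A A' : Site d → Fin d → 𝔸} {x : Site d} (μ : Fin d)
    (h : ∀ (y : Site d) (τ : Fin d), (∀ i, x i - 1 ≤ y i ∧ y i ≤ x i + 1) → A y τ = A' y τ) :
    Jcur η U₀ A μ x = Jcur η U₀ A' μ x := by
  have hx : ∀ τ, A x τ = A' x τ := fun τ => h x τ (near_pts x μ μ).1
  have hp : ∀ ν τ, A (x + e ν) τ = A' (x + e ν) τ := fun ν τ => h _ τ (near_pts x ν μ).2.1
  have hm : ∀ ν τ, A (x - e ν) τ = A' (x - e ν) τ := fun ν τ => h _ τ (near_pts x ν μ).2.2.1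
  have hmp : ∀ ν κ τ, A (x - e ν + e κ) τ = A' (x - e ν + e κ) τ := fun ν κ τ => h _ τ (near_pts x ν κ).2.2.2
  rw [B8Eq155JBound.Jcur_def, B8Eq155JBound.Jcur_def]
  unfold pdiv
  congr 1 <;> refine Finset.sum_congr rfl fun ν _ => ?_ <;>
    simp only [covDeriv, B8Eq146AExpansion.plaqCovDeriv_eq_covDerivFwd, covDerivFwd, sub_add_cancel, hx, hp, hm, hmp]

/-- `J(0) = 0`. [cite: Balaban1985RegularSpaces, (1.55) p.86] -/
theorem Jcur_zero (η : ℝ) (U₀ : Site d → Fin d → 𝔸ˣ) (μ : Fin d) (x : Site d) : Jcur η U₀ (0 : Site d → Fin d → 𝔸) μ x = 0 := by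
  rw [B8Eq155JBound.Jcur_def]
  unfold pdiv
  simp [covDeriv, B8Eq146AExpansion.plaqCovDeriv_eq_covDerivFwd, covDerivFwd, conjR]

/-- **ℓ∞-LOCALITY OF `Δ^η_{U₀}`**: `(Δ^η_{U₀}f)(x)` reads `f` on the ℓ∞-unit ball of `x` only (`x`, `x ± e_κ`). [cite: Balaban1985BackgroundPropagators, (3.23) p.394] -/
theorem covLap_congr_ball {η : ℝ} {U₀ : Site d → Fin d → 𝔸ˣ} {f g : Site d → 𝔸} {x : Site d}
    (h : ∀ y : Site d, (∀ i, x i - 1 ≤ y i ∧ y i ≤ x i + 1) → f y = g y) : covLap η U₀ f x = covLap η U₀ g x := by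
  have hx : f x = g x := h x fun i => ⟨by linarith, by linarith⟩
  have hp : ∀ μ : Fin d, f (x + e μ) = g (x + e μ) := fun μ => h _ (near_pts x μ μ).2.1
  have hm : ∀ μ : Fin d, f (x - e μ) = g (x - e μ) := fun μ => h _ (near_pts x μ μ).2.2.1
  unfold covLap covDivB
  refine Finset.sum_congr rfl fun μ _ => ?_
  simp only [covDeriv, covDerivFwd, sub_add_cancel, hx, hp μ, hm μ]

/-! ### §3.5 Geometry: sides and bonds near `Ω_j`; under `Margin2` every outer interaction sits at level `0` -/

omit [CStarAlgebra 𝔸] in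
/-- A side of a plaquette touching `S` has both end-points in the ℓ∞-unit ball of a point of `S` (the vertices of a plaquette are pairwise
at ℓ∞-distance `≤ 1`). [cite: Balaban1985RegularSpaces, p.77 (convention before (1.5)), (1.2) p.76] -/
theorem exists_near_of_sideTouches {S : Set (Site d)} {y : Site d} {τ : Fin d} (h : SideTouches S y τ) :
    ∃ v ∈ S, (∀ i, v i - 1 ≤ y i ∧ y i ≤ v i + 1) ∧ (∀ i, v i - 1 ≤ (y + e τ) i ∧ (y + e τ) i ≤ v i + 1) := by
  obtain ⟨z, κ, ν, hκν, hp, hs⟩ := h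
  have hne : (κ : ℕ) ≠ ν := fun h => hκν (Fin.ext h)
  rcases hp with hv | hv | hv | hv <;> rcases hs with ⟨rfl, rfl⟩ | ⟨rfl, rfl⟩ | ⟨rfl, rfl⟩ | ⟨rfl, rfl⟩ <;>
    refine ⟨_, hv, fun i => ?_, fun i => ?_⟩ <;>
    (try simp only [Pi.add_apply, B7Prop1Explicit.e_apply]) <;> (try split_ifs) <;> (try subst_vars) <;> omega

omit [CStarAlgebra 𝔸] in
/-- A bond of `S` (one end-point in `S`) has its base point in the ℓ∞-unit ball of a point of `S`. [cite: Balaban1985RegularSpaces, p.77 (bond convention)] -/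
theorem exists_near_of_bondTouches {S : Set (Site d)} {x : Site d} {μ : Fin d} (h : BondTouches S x μ) :
    ∃ v ∈ S, ∀ i, v i - 1 ≤ x i ∧ x i ≤ v i + 1 := by
  rcases h with hv | hv
  · exact ⟨x, hv, fun i => ⟨by linarith, by linarith⟩⟩
  · refine ⟨x + e μ, hv, fun i => ?_⟩
    simp only [Pi.add_apply, B7Prop1Explicit.e_apply]
    split_ifs <;> omega

omit [CStarAlgebra 𝔸] in
/-- **Under `Margin2`, a side of a plaquette touching `Ω_j`, `j ≥ 1`, is a bond of `Ω₀`** (indeed both its end-points lie in `Ω₀`).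
[cite: Balaban1985RegularSpaces, p.98 (margins of the cubes □_j), p.77 (bond convention)] -/
theorem bondTouches_zero_of_sideTouches {Ω : ℕ → Set (Site d)} (hM : Margin2 Ω) {j : ℕ} (hj : 1 ≤ j) {y : Site d} {τ : Fin d}
    (h : SideTouches (Ω j) y τ) : BondTouches (Ω 0) y τ := by
  obtain ⟨v, hv, hy, -⟩ := exists_near_of_sideTouches h
  exact Or.inl (hM j hj v hv y fun i => ⟨by linarith [(hy i).1], by linarith [(hy i).2]⟩)

omit [CStarAlgebra 𝔸] in
/-- Under `Margin2`: if `⟨y, y + e_τ⟩` is a side of a plaquette touching `Ω_j`, `j ≥ 1`, then every site of the ℓ∞-unit ball of `y` lies in `Ω₀`.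
[cite: Balaban1985RegularSpaces, p.98 (margins of the cubes □_j)] -/
theorem mem_zero_of_near_sideTouches {Ω : ℕ → Set (Site d)} (hM : Margin2 Ω) {j : ℕ} (hj : 1 ≤ j) {y : Site d} {τ : Fin d}
    (h : SideTouches (Ω j) y τ) {w : Site d} (hw : ∀ i, y i - 1 ≤ w i ∧ w i ≤ y i + 1) : w ∈ Ω 0 := by
  obtain ⟨v, hv, hy, -⟩ := exists_near_of_sideTouches h
  exact hM j hj v hv w fun i => ⟨by linarith [(hy i).1, (hw i).1], by linarith [(hy i).2, (hw i).2]⟩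

omit [CStarAlgebra 𝔸] in
/-- Under `Margin2`: if `⟨x, x + e_μ⟩` is a bond of `Ω_j`, `j ≥ 1`, then every site of the ℓ∞-unit ball of `x` lies in `Ω₀`.
[cite: Balaban1985RegularSpaces, p.98 (margins of the cubes □_j)] -/
theorem mem_zero_of_near_bondTouches {Ω : ℕ → Set (Site d)} (hM : Margin2 Ω) {j : ℕ} (hj : 1 ≤ j) {x : Site d} {μ : Fin d}
    (h : BondTouches (Ω j) x μ) {w : Site d} (hw : ∀ i, x i - 1 ≤ w i ∧ w i ≤ x i + 1) : w ∈ Ω 0 := by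
  obtain ⟨v, hv, hx⟩ := exists_near_of_bondTouches h
  exact hM j hj v hv w fun i => ⟨by linarith [(hx i).1, (hw i).1], by linarith [(hx i).2, (hw i).2]⟩

/-- Under `Margin2`, at a side of a plaquette touching `Ω_j`, `j ≥ 1`, the outer part VANISHES (line 1 of (1.59) sees the exterior data at level
`0` only). [cite: Balaban1985RegularSpaces, (1.59) p.86, p.98] -/
theorem outerPart_eq_zero_of_sideTouches {Ω : ℕ → Set (Site d)} (hM : Margin2 Ω) (A : Site d → Fin d → 𝔸) {j : ℕ} (hj : 1 ≤ j)
    {y : Site d} {τ : Fin d} (h : SideTouches (Ω j) y τ) : outerPart (Ω 0) A y τ = 0 :=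
  outerPart_of A (bondTouches_zero_of_sideTouches hM hj h)

/-- Under `Margin2`, the covariant gradient of the outer part VANISHES at every side of a plaquette touching `Ω_j`, `j ≥ 1`, in every direction
(line 2 of (1.59) sees the exterior data at level `0` only). [cite: Balaban1985RegularSpaces, (1.59) p.86, (1.1) p.76, p.98] -/
theorem covDerivFwd_outerPart_eq_zero {Ω : ℕ → Set (Site d)} (hM : Margin2 Ω) (η : ℝ) (U₀ : Site d → Fin d → 𝔸ˣ)
    (A : Site d → Fin d → 𝔸) {j : ℕ} (hj : 1 ≤ j) {y : Site d} {τ : Fin d} (h : SideTouches (Ω j) y τ) (κ : Fin d) :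
    covDerivFwd η U₀ κ (fun z => outerPart (Ω 0) A z τ) y = 0 := by
  have h0 : outerPart (Ω 0) A y τ = 0 := outerPart_eq_zero_of_sideTouches hM A hj h
  have h1 : outerPart (Ω 0) A (y + e κ) τ = 0 := by
    refine outerPart_of A (Or.inl (mem_zero_of_near_sideTouches hM hj h fun i => ?_))
    simp only [Pi.add_apply, B7Prop1Explicit.e_apply]
    split_ifs <;> omega
  simp [covDerivFwd, h0, h1, conjR]

/-- Under `Margin2`, the current `J(A − 𝟙_{Ω₀}A)` of the outer part VANISHES at every bond of `Ω_j`, `j ≥ 1` (all bonds it reads are bonds of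
`Ω₀`). [cite: Balaban1985RegularSpaces, (1.55) p.86, p.98] -/
theorem Jcur_outerPart_eq_zero {Ω : ℕ → Set (Site d)} (hM : Margin2 Ω) (η : ℝ) (U₀ : Site d → Fin d → 𝔸ˣ) (A : Site d → Fin d → 𝔸)
    {j : ℕ} (hj : 1 ≤ j) {x : Site d} {μ : Fin d} (h : BondTouches (Ω j) x μ) : Jcur η U₀ (outerPart (Ω 0) A) μ x = 0 := by
  rw [← Jcur_zero η U₀ μ x]
  refine Jcur_congr_ball μ fun y τ hy => ?_
  exact outerPart_of A (Or.inl (mem_zero_of_near_bondTouches hM hj h hy))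

/-- Under `Margin2`, the covariant Laplacian of (a component of) the outer part VANISHES at every bond of `Ω_j`, `j ≥ 1` (line 4 of (1.59)
sees the exterior data at level `0` only). [cite: Balaban1985BackgroundPropagators, (3.23) p.394; Balaban1985RegularSpaces, (1.59) p.86, p.98] -/
theorem covLap_outerPart_eq_zero {Ω : ℕ → Set (Site d)} (hM : Margin2 Ω) (η : ℝ) (U₀ : Site d → Fin d → 𝔸ˣ) (A : Site d → Fin d → 𝔸)
    {j : ℕ} (hj : 1 ≤ j) {x : Site d} {μ : Fin d} (h : BondTouches (Ω j) x μ) :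
    covLap η U₀ (fun z => outerPart (Ω 0) A z μ) x = 0 := by
  rw [← B8Eq138LandauZd.covLap_zero (η := η) (U₀ := U₀) x]
  refine covLap_congr_ball fun y hy => ?_
  exact outerPart_of A (Or.inl (mem_zero_of_near_bondTouches hM hj h hy))

/-! ### §3.6 The level-0 collar functional `Φ₀` controls the outer part pointwise -/

/-- **THE OUTER PART IS POINTWISE BELOW `η⁻¹Φ₀`**, `Φ₀(A) = sup_{b ∈ collar} η‖A(b)‖` the level-0 collar functional of dag-n05-e's repaired
sockets (the index set `j = 0 ∧ SideTouches (Ω 0) b ∧ ¬ BondTouches (Ω 0) b`): under `Margin2`, for a field vanishing off the sides of the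
plaquettes touching the `Ω_j`, `j ≤ m` (the socket's support clause), whose collar family is bounded.
[cite: Balaban1985RegularSpaces, (1.41) p.83, (1.133) p.99, p.77] -/
theorem norm_outerPart_le_phi {L m : ℕ} {η : ℝ} (hη : 0 < η) {Ω : ℕ → Set (Site d)} (hM : Margin2 Ω) {A : Site d → Fin d → 𝔸}
    (hA0 : ∀ (y : Site d) (τ : Fin d), (∀ j, j ≤ m → ¬ SideTouches (Ω j) y τ) → A y τ = 0)
    (hbd : Bdd L m η (-(1 : ℝ)) (fun j (b : Site d × Fin d) => j = 0 ∧ SideTouches (Ω 0) b.1 b.2 ∧ ¬ BondTouches (Ω 0) b.1 b.2)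
      (fun b => A b.1 b.2))
    (y : Site d) (τ : Fin d) :
    ‖outerPart (Ω 0) A y τ‖ ≤ η⁻¹ * msup L m η (-(1 : ℝ))
      (fun j (b : Site d × Fin d) => j = 0 ∧ SideTouches (Ω 0) b.1 b.2 ∧ ¬ BondTouches (Ω 0) b.1 b.2) (fun b => A b.1 b.2) := by
  have hΦ0 : 0 ≤ msup L m η (-(1 : ℝ))
      (fun j (b : Site d × Fin d) => j = 0 ∧ SideTouches (Ω 0) b.1 b.2 ∧ ¬ BondTouches (Ω 0) b.1 b.2) (fun b => A b.1 b.2) :=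
    B8ScaledSupNorm.msup_nonneg L m hη.le _ _ _
  have hrhs : 0 ≤ η⁻¹ * msup L m η (-(1 : ℝ))
      (fun j (b : Site d × Fin d) => j = 0 ∧ SideTouches (Ω 0) b.1 b.2 ∧ ¬ BondTouches (Ω 0) b.1 b.2) (fun b => A b.1 b.2) :=
    mul_nonneg (inv_nonneg.mpr hη.le) hΦ0
  by_cases hb : BondTouches (Ω 0) y τ
  · rw [outerPart_of A hb, norm_zero]; exact hrhs
  rw [outerPart_of_not A hb]
  by_cases hs : ∃ j, j ≤ m ∧ SideTouches (Ω j) y τ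
  · obtain ⟨j, hjm, hsj⟩ := hs
    rcases Nat.eq_zero_or_pos j with rfl | hjpos
    · have h := B8ScaledSupNorm.weight_mul_norm_le_msup hbd (Nat.zero_le m) (i := (y, τ)) ⟨rfl, hsj, hb⟩
      have e1 : (-(1 : ℝ)) = -((1 : ℕ) : ℝ) := by norm_num
      rw [e1, B8ScaledSupNorm.weight_neg_natCast, pow_one, pow_zero, one_mul] at h
      rw [e1]
      calc ‖A y τ‖ = η⁻¹ * (η * ‖A y τ‖) := by rw [← mul_assoc, inv_mul_cancel₀ hη.ne', one_mul]
        _ ≤ _ := mul_le_mul_of_nonneg_left h (inv_nonneg.mpr hη.le)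
    · exact absurd (bondTouches_zero_of_sideTouches hM hjpos hsj) hb
  · push Not at hs
    rw [hA0 y τ fun j hj => hs j hj, norm_zero]
    exact hrhs

/-! ### §3.7 The four collar estimates (lines 1, 2, 4 of (1.59) and the current) -/

section CollarEstimates

/-- Bounded families transfer along pointwise norm domination (bookkeeping for the boundedness side condition of the p. 86 weighted supremum,
r05's `Bdd`). [cite: Balaban1985RegularSpaces, p.86 (definition after (1.55))] -/
theorem bdd_of_norm_le {ι E F : Type*} [SeminormedAddCommGroup E] [SeminormedAddCommGroup F] {L k : ℕ} {η α : ℝ}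
    {mem : ℕ → ι → Prop} {F₁ : ι → E} {F₂ : ι → F} (h : ∀ i, ‖F₁ i‖ ≤ ‖F₂ i‖) (hη : 0 ≤ η) (hB : Bdd L k η α mem F₂) :
    Bdd L k η α mem F₁ := by
  obtain ⟨c, hc⟩ := hB
  exact ⟨c, fun j hj i hi => (mul_le_mul_of_nonneg_left (h i) (B8ScaledSupNorm.weight_nonneg L hη α j)).trans (hc j hj i hi)⟩

/-- **LINE 1: `|A|₍₋₁₎ ≤ |𝟙_{Ω₀}A|₍₋₁₎ + Φ`** over the sides of the plaquettes touching the `Ω_j` — under `Margin2`, for a field whose outer part is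
pointwise below `η⁻¹Φ` and whose weighted family is bounded. [cite: Balaban1985RegularSpaces, (1.59) p.86 (first line), p.98] -/
theorem msup_side_le_restrict_add {L m : ℕ} {η : ℝ} (hη : 0 < η) {Ω : ℕ → Set (Site d)} (hM : Margin2 Ω)
    {A : Site d → Fin d → 𝔸} {Φ : ℝ} (hΦ : 0 ≤ Φ) (hout : ∀ (y : Site d) (τ : Fin d), ‖outerPart (Ω 0) A y τ‖ ≤ η⁻¹ * Φ)
    (hbd : Bdd L m η (-(1 : ℝ)) (fun j (b : Site d × Fin d) => SideTouches (Ω j) b.1 b.2) (fun b => A b.1 b.2)) :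
    msup L m η (-(1 : ℝ)) (fun j (b : Site d × Fin d) => SideTouches (Ω j) b.1 b.2) (fun b => A b.1 b.2) ≤
      msup L m η (-(1 : ℝ)) (fun j (b : Site d × Fin d) => SideTouches (Ω j) b.1 b.2) (fun b => restrictDom (Ω 0) A b.1 b.2) + Φ := by
  have e1 : (-(1 : ℝ)) = -((1 : ℕ) : ℝ) := by norm_num
  have hbdr : Bdd L m η (-(1 : ℝ)) (fun j (b : Site d × Fin d) => SideTouches (Ω j) b.1 b.2) (fun b => restrictDom (Ω 0) A b.1 b.2) :=
    bdd_of_norm_le (fun b => norm_restrictDom_le (Ω 0) A b.1 b.2) hη.le hbd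
  have hR0 : 0 ≤ msup L m η (-(1 : ℝ)) (fun j (b : Site d × Fin d) => SideTouches (Ω j) b.1 b.2) (fun b => restrictDom (Ω 0) A b.1 b.2) :=
    B8ScaledSupNorm.msup_nonneg L m hη.le _ _ _
  refine B8ScaledSupNorm.msup_le (add_nonneg hR0 hΦ) fun j hj b hb => ?_
  have hsplit : ‖A b.1 b.2‖ ≤ ‖restrictDom (Ω 0) A b.1 b.2‖ + ‖outerPart (Ω 0) A b.1 b.2‖ := by
    have h := congrFun (congrFun (restrictDom_add_outerPart (Ω 0) A) b.1) b.2
    simp only [Pi.add_apply] at h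
    calc ‖A b.1 b.2‖ = ‖restrictDom (Ω 0) A b.1 b.2 + outerPart (Ω 0) A b.1 b.2‖ := by rw [h]
      _ ≤ _ := norm_add_le _ _
  have hw0 : 0 ≤ weight L η (-(1 : ℝ)) j := B8ScaledSupNorm.weight_nonneg L hη.le _ j
  have h1 : weight L η (-(1 : ℝ)) j * ‖restrictDom (Ω 0) A b.1 b.2‖ ≤
      msup L m η (-(1 : ℝ)) (fun j (b : Site d × Fin d) => SideTouches (Ω j) b.1 b.2) (fun b => restrictDom (Ω 0) A b.1 b.2) :=
    B8ScaledSupNorm.weight_mul_norm_le_msup hbdr hj hb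
  have h2 : weight L η (-(1 : ℝ)) j * ‖outerPart (Ω 0) A b.1 b.2‖ ≤ Φ := by
    rcases Nat.eq_zero_or_pos j with rfl | hjpos
    · rw [e1, B8ScaledSupNorm.weight_neg_natCast, pow_one, pow_zero, one_mul]
      calc η * ‖outerPart (Ω 0) A b.1 b.2‖ ≤ η * (η⁻¹ * Φ) := mul_le_mul_of_nonneg_left (hout b.1 b.2) hη.le
        _ = Φ := by rw [← mul_assoc, mul_inv_cancel₀ hη.ne', one_mul]
    · rw [outerPart_eq_zero_of_sideTouches hM A hjpos hb, norm_zero, mul_zero]; exact hΦ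
  calc weight L η (-(1 : ℝ)) j * ‖A b.1 b.2‖
      ≤ weight L η (-(1 : ℝ)) j * (‖restrictDom (Ω 0) A b.1 b.2‖ + ‖outerPart (Ω 0) A b.1 b.2‖) := mul_le_mul_of_nonneg_left hsplit hw0
    _ ≤ _ := by rw [mul_add]; exact add_le_add h1 h2

/-- A uniform pointwise bound gives a bounded `(Lʲη)ⁿ`-weighted family over the levels `j ≤ m` (`L ≥ 1`, `η > 0`): the boundedness side
condition of r05's `msup` for the exponents `α = −n` of (1.59). [cite: Balaban1985RegularSpaces, p.86 (definition after (1.55))] -/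
theorem bdd_neg_of_pointwise {ι E : Type*} [SeminormedAddCommGroup E] {L m : ℕ} (hL : 1 ≤ L) {η : ℝ} (hη : 0 < η) (n : ℕ)
    {mem : ℕ → ι → Prop} {F : ι → E} {c : ℝ} (h : ∀ i, ‖F i‖ ≤ c) : Bdd L m η (-(n : ℝ)) mem F := by
  refine B8ScaledSupNorm.bdd_of_forall (c := ((L : ℝ) ^ m * η) ^ n * max c 0) fun j hj i _ => ?_
  rw [B8ScaledSupNorm.weight_neg_natCast]
  have hLr : (1 : ℝ) ≤ L := by exact_mod_cast hL
  have h1 : ((L : ℝ) ^ j * η) ^ n ≤ ((L : ℝ) ^ m * η) ^ n :=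
    pow_le_pow_left₀ (by positivity) (mul_le_mul_of_nonneg_right (pow_le_pow_right₀ hLr hj) hη.le) n
  exact mul_le_mul h1 ((h i).trans (le_max_left _ _)) (norm_nonneg _) (by positivity)

variable [Nontrivial 𝔸]

/-- **LINE 2: `|∇^η_{U₀}A|₍₋₂₎ ≤ |∇^η_{U₀}𝟙_{Ω₀}A|₍₋₂₎ + 2Φ`** over the sides of the plaquettes touching the `Ω_j` (all components of the forward
covariant gradient) — under `Margin2`, for a `U1`-valued background, a uniformly bounded field whose outer part is pointwise below `η⁻¹Φ`.
[cite: Balaban1985RegularSpaces, (1.59) p.86 (second line), (1.1) p.76, p.98] -/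
theorem msup_grad_le_restrict_add {L m : ℕ} (hL : 1 ≤ L) {η : ℝ} (hη : 0 < η) {Ω : ℕ → Set (Site d)} (hM : Margin2 Ω)
    {U₀ : Site d → Fin d → 𝔸ˣ} (hU₀ : ∀ y κ, U₀ y κ ∈ U1 𝔸) {A : Site d → Fin d → 𝔸} {Φ a : ℝ} (hΦ : 0 ≤ Φ)
    (hout : ∀ (y : Site d) (τ : Fin d), ‖outerPart (Ω 0) A y τ‖ ≤ η⁻¹ * Φ) (ha : ∀ (y : Site d) (τ : Fin d), ‖A y τ‖ ≤ a) :
    msup L m η (-(2 : ℝ)) (fun j (t : Fin d × Fin d × Site d) => SideTouches (Ω j) t.2.2 t.2.1)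
        (fun t => covDerivFwd η U₀ t.1 (fun z => A z t.2.1) t.2.2) ≤
      msup L m η (-(2 : ℝ)) (fun j (t : Fin d × Fin d × Site d) => SideTouches (Ω j) t.2.2 t.2.1)
        (fun t => covDerivFwd η U₀ t.1 (fun z => restrictDom (Ω 0) A z t.2.1) t.2.2) + 2 * Φ := by
  have e2 : (-(2 : ℝ)) = -((2 : ℕ) : ℝ) := by norm_num
  -- the restricted gradient family is bounded
  have hbdr : Bdd L m η (-(2 : ℝ)) (fun j (t : Fin d × Fin d × Site d) => SideTouches (Ω j) t.2.2 t.2.1)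
      (fun t => covDerivFwd η U₀ t.1 (fun z => restrictDom (Ω 0) A z t.2.1) t.2.2) := by
    rw [e2]
    refine bdd_neg_of_pointwise hL hη 2 (c := η⁻¹ * (a + a)) fun t => ?_
    refine (norm_covDerivFwd_le hη (hU₀ _ _) _).trans (mul_le_mul_of_nonneg_left ?_ (inv_nonneg.mpr hη.le))
    exact add_le_add ((norm_restrictDom_le _ A _ _).trans (ha _ _)) ((norm_restrictDom_le _ A _ _).trans (ha _ _))
  have hR0 : 0 ≤ msup L m η (-(2 : ℝ)) (fun j (t : Fin d × Fin d × Site d) => SideTouches (Ω j) t.2.2 t.2.1)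
      (fun t => covDerivFwd η U₀ t.1 (fun z => restrictDom (Ω 0) A z t.2.1) t.2.2) :=
    B8ScaledSupNorm.msup_nonneg L m hη.le _ _ _
  refine B8ScaledSupNorm.msup_le (by positivity) fun j hj t ht => ?_
  -- split the gradient
  have hsplit : covDerivFwd η U₀ t.1 (fun z => A z t.2.1) t.2.2 =
      covDerivFwd η U₀ t.1 (fun z => restrictDom (Ω 0) A z t.2.1) t.2.2 +
        covDerivFwd η U₀ t.1 (fun z => outerPart (Ω 0) A z t.2.1) t.2.2 := by
    rw [← B8LambdaSpaceKLevel.covDerivFwd_add', restrictDom_add_outerPart_comp]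
  have hw0 : 0 ≤ weight L η (-(2 : ℝ)) j := B8ScaledSupNorm.weight_nonneg L hη.le _ j
  have h1 : weight L η (-(2 : ℝ)) j * ‖covDerivFwd η U₀ t.1 (fun z => restrictDom (Ω 0) A z t.2.1) t.2.2‖ ≤
      msup L m η (-(2 : ℝ)) (fun j (t : Fin d × Fin d × Site d) => SideTouches (Ω j) t.2.2 t.2.1)
        (fun t => covDerivFwd η U₀ t.1 (fun z => restrictDom (Ω 0) A z t.2.1) t.2.2) :=
    B8ScaledSupNorm.weight_mul_norm_le_msup hbdr hj ht
  have h2 : weight L η (-(2 : ℝ)) j * ‖covDerivFwd η U₀ t.1 (fun z => outerPart (Ω 0) A z t.2.1) t.2.2‖ ≤ 2 * Φ := by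
    rcases Nat.eq_zero_or_pos j with rfl | hjpos
    · rw [e2, B8ScaledSupNorm.weight_neg_natCast, pow_zero, one_mul]
      have hg : ‖covDerivFwd η U₀ t.1 (fun z => outerPart (Ω 0) A z t.2.1) t.2.2‖ ≤ η⁻¹ * (η⁻¹ * Φ + η⁻¹ * Φ) :=
        (norm_covDerivFwd_le hη (hU₀ _ _) _).trans
          (mul_le_mul_of_nonneg_left (add_le_add (hout _ _) (hout _ _)) (inv_nonneg.mpr hη.le))
      calc η ^ 2 * ‖covDerivFwd η U₀ t.1 (fun z => outerPart (Ω 0) A z t.2.1) t.2.2‖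
          ≤ η ^ 2 * (η⁻¹ * (η⁻¹ * Φ + η⁻¹ * Φ)) := mul_le_mul_of_nonneg_left hg (by positivity)
        _ = 2 * Φ := by field_simp; ring
    · rw [covDerivFwd_outerPart_eq_zero hM η U₀ A hjpos ht t.1, norm_zero, mul_zero]
      positivity
  rw [hsplit]
  calc weight L η (-(2 : ℝ)) j * ‖covDerivFwd η U₀ t.1 (fun z => restrictDom (Ω 0) A z t.2.1) t.2.2 +
          covDerivFwd η U₀ t.1 (fun z => outerPart (Ω 0) A z t.2.1) t.2.2‖
      ≤ weight L η (-(2 : ℝ)) j * (‖covDerivFwd η U₀ t.1 (fun z => restrictDom (Ω 0) A z t.2.1) t.2.2‖ +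
          ‖covDerivFwd η U₀ t.1 (fun z => outerPart (Ω 0) A z t.2.1) t.2.2‖) := mul_le_mul_of_nonneg_left (norm_add_le _ _) hw0
    _ ≤ _ := by rw [mul_add]; exact add_le_add h1 h2

/-- **THE CURRENT: `|J(𝟙_{Ω₀}A)|₍₋₃₎ ≤ |J(A)|₍₋₃₎ + 16d·Φ`** over the bonds of the `Ω_j` (`J = D^{η*}_{U₀}D^η_{U₀}`, (1.55)) — under `Margin2`, for a
`U1`-valued background, a uniformly bounded field whose outer part is pointwise below `η⁻¹Φ`: the source of the restricted field costs one collar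
term. [cite: Balaban1985RegularSpaces, (1.55) p.86, (1.59) p.86, p.98] -/
theorem bondNorm_jcur_restrict_le {L m : ℕ} (hL : 1 ≤ L) {η : ℝ} (hη : 0 < η) {Ω : ℕ → Set (Site d)} (hM : Margin2 Ω)
    {U₀ : Site d → Fin d → 𝔸ˣ} (hU₀ : ∀ y κ, U₀ y κ ∈ U1 𝔸) {A : Site d → Fin d → 𝔸} {Φ a : ℝ} (hΦ : 0 ≤ Φ)
    (hout : ∀ (y : Site d) (τ : Fin d), ‖outerPart (Ω 0) A y τ‖ ≤ η⁻¹ * Φ) (ha : ∀ (y : Site d) (τ : Fin d), ‖A y τ‖ ≤ a) :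
    bondNorm L m η (-(3 : ℝ)) Ω (fun x μ => Jcur η U₀ (restrictDom (Ω 0) A) μ x) ≤
      bondNorm L m η (-(3 : ℝ)) Ω (fun x μ => Jcur η U₀ A μ x) + 16 * d * Φ := by
  have e3 : (-(3 : ℝ)) = -((3 : ℕ) : ℝ) := by norm_num
  -- the current of `A` is bounded (A is)
  have hgrad : ∀ (y : Site d) (κ τ : Fin d), ‖covDerivFwd η U₀ κ (fun z => A z τ) y‖ ≤ η⁻¹ * (a + a) := fun y κ τ =>
    (norm_covDerivFwd_le hη (hU₀ _ _) _).trans (mul_le_mul_of_nonneg_left (add_le_add (ha _ _) (ha _ _)) (inv_nonneg.mpr hη.le))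
  have hbdJ : Bdd L m η (-(3 : ℝ)) (fun j (b : Site d × Fin d) => BondTouches (Ω j) b.1 b.2) (fun b => Jcur η U₀ A b.2 b.1) := by
    rw [e3]
    exact bdd_neg_of_pointwise hL hη 3 fun b => B9SupplySockB9P3Zd.norm_Jcur_le_of_grad hη hU₀ hgrad b.2 b.1
  have hJ0 : 0 ≤ bondNorm L m η (-(3 : ℝ)) Ω (fun x μ => Jcur η U₀ A μ x) := B8ScaledSupNorm.msup_nonneg L m hη.le _ _ _
  -- the current of the outer part, pointwise
  have hgo : ∀ (y : Site d) (κ τ : Fin d), ‖covDerivFwd η U₀ κ (fun z => outerPart (Ω 0) A z τ) y‖ ≤ η⁻¹ * (η⁻¹ * Φ + η⁻¹ * Φ) :=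
    fun y κ τ => (norm_covDerivFwd_le hη (hU₀ _ _) _).trans
      (mul_le_mul_of_nonneg_left (add_le_add (hout _ _) (hout _ _)) (inv_nonneg.mpr hη.le))
  have hJo : ∀ (μ : Fin d) (x : Site d), ‖Jcur η U₀ (outerPart (Ω 0) A) μ x‖ ≤ 8 * d * (η⁻¹ * (η⁻¹ * (η⁻¹ * Φ + η⁻¹ * Φ))) :=
    fun μ x => B9SupplySockB9P3Zd.norm_Jcur_le_of_grad hη hU₀ hgo μ x
  unfold bondNorm
  refine B8ScaledSupNorm.msup_le (by positivity) fun j hj b hb => ?_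
  dsimp only
  have hsplit : Jcur η U₀ (restrictDom (Ω 0) A) b.2 b.1 = Jcur η U₀ A b.2 b.1 - Jcur η U₀ (outerPart (Ω 0) A) b.2 b.1 := by
    rw [eq_sub_iff_add_eq, ← Jcur_add, restrictDom_add_outerPart]
  have hw0 : 0 ≤ weight L η (-(3 : ℝ)) j := B8ScaledSupNorm.weight_nonneg L hη.le _ j
  have h1 : weight L η (-(3 : ℝ)) j * ‖Jcur η U₀ A b.2 b.1‖ ≤
      msup L m η (-(3 : ℝ)) (fun j (b : Site d × Fin d) => BondTouches (Ω j) b.1 b.2) (fun b => Jcur η U₀ A b.2 b.1) :=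
    B8ScaledSupNorm.weight_mul_norm_le_msup hbdJ hj hb
  have h2 : weight L η (-(3 : ℝ)) j * ‖Jcur η U₀ (outerPart (Ω 0) A) b.2 b.1‖ ≤ 16 * d * Φ := by
    rcases Nat.eq_zero_or_pos j with rfl | hjpos
    · rw [e3, B8ScaledSupNorm.weight_neg_natCast, pow_zero, one_mul]
      calc η ^ 3 * ‖Jcur η U₀ (outerPart (Ω 0) A) b.2 b.1‖ ≤ η ^ 3 * (8 * d * (η⁻¹ * (η⁻¹ * (η⁻¹ * Φ + η⁻¹ * Φ)))) :=
            mul_le_mul_of_nonneg_left (hJo b.2 b.1) (by positivity)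
        _ = 16 * d * Φ := by field_simp; ring
    · rw [Jcur_outerPart_eq_zero hM η U₀ A hjpos hb, norm_zero, mul_zero]
      positivity
  rw [hsplit]
  calc weight L η (-(3 : ℝ)) j * ‖Jcur η U₀ A b.2 b.1 - Jcur η U₀ (outerPart (Ω 0) A) b.2 b.1‖
      ≤ weight L η (-(3 : ℝ)) j * (‖Jcur η U₀ A b.2 b.1‖ + ‖Jcur η U₀ (outerPart (Ω 0) A) b.2 b.1‖) :=
        mul_le_mul_of_nonneg_left (norm_sub_le _ _) hw0
    _ ≤ _ := by rw [mul_add]; exact add_le_add h1 h2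

/-- **LINE 4: `|Δ^η_{U₀}A|₍₋₃₎ ≤ |Δ^η_{U₀}𝟙_{Ω₀}A|₍₋₃₎ + 4d·Φ`** over the bonds of the `Ω_j` (componentwise covariant Laplacian) — under `Margin2`, for a
`U1`-valued background, a uniformly bounded field whose outer part is pointwise below `η⁻¹Φ`.
[cite: Balaban1985RegularSpaces, (1.59) p.86 (fourth line), p.98; Balaban1985BackgroundPropagators, (3.23) p.394] -/
theorem bondNorm_covLap_le_restrict_add {L m : ℕ} (hL : 1 ≤ L) {η : ℝ} (hη : 0 < η) {Ω : ℕ → Set (Site d)} (hM : Margin2 Ω)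
    {U₀ : Site d → Fin d → 𝔸ˣ} (hU₀ : ∀ y κ, U₀ y κ ∈ U1 𝔸) {A : Site d → Fin d → 𝔸} {Φ a : ℝ} (hΦ : 0 ≤ Φ)
    (hout : ∀ (y : Site d) (τ : Fin d), ‖outerPart (Ω 0) A y τ‖ ≤ η⁻¹ * Φ) (ha : ∀ (y : Site d) (τ : Fin d), ‖A y τ‖ ≤ a) :
    bondNorm L m η (-(3 : ℝ)) Ω (fun x μ => covLap η U₀ (fun z => A z μ) x) ≤
      bondNorm L m η (-(3 : ℝ)) Ω (fun x μ => covLap η U₀ (fun z => restrictDom (Ω 0) A z μ) x) + 4 * d * Φ := by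
  have e3 : (-(3 : ℝ)) = -((3 : ℕ) : ℝ) := by norm_num
  have hbdr : Bdd L m η (-(3 : ℝ)) (fun j (b : Site d × Fin d) => BondTouches (Ω j) b.1 b.2)
      (fun b => covLap η U₀ (fun z => restrictDom (Ω 0) A z b.2) b.1) := by
    rw [e3]
    exact bdd_neg_of_pointwise hL hη 3 fun b =>
      norm_covLap_le hη hU₀ (fun y => (norm_restrictDom_le (Ω 0) A y b.2).trans (ha y b.2)) b.1
  have hR0 : 0 ≤ bondNorm L m η (-(3 : ℝ)) Ω (fun x μ => covLap η U₀ (fun z => restrictDom (Ω 0) A z μ) x) :=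
    B8ScaledSupNorm.msup_nonneg L m hη.le _ _ _
  have hLo : ∀ (μ : Fin d) (x : Site d), ‖covLap η U₀ (fun z => outerPart (Ω 0) A z μ) x‖ ≤ 4 * d * (η⁻¹ * (η⁻¹ * (η⁻¹ * Φ))) :=
    fun μ x => norm_covLap_le hη hU₀ (fun y => hout y μ) x
  unfold bondNorm
  refine B8ScaledSupNorm.msup_le (by positivity) fun j hj b hb => ?_
  dsimp only
  have hsplit : covLap η U₀ (fun z => A z b.2) b.1 =
      covLap η U₀ (fun z => restrictDom (Ω 0) A z b.2) b.1 + covLap η U₀ (fun z => outerPart (Ω 0) A z b.2) b.1 := by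
    rw [← covLap_add, restrictDom_add_outerPart_comp]
  have hw0 : 0 ≤ weight L η (-(3 : ℝ)) j := B8ScaledSupNorm.weight_nonneg L hη.le _ j
  have h1 : weight L η (-(3 : ℝ)) j * ‖covLap η U₀ (fun z => restrictDom (Ω 0) A z b.2) b.1‖ ≤
      msup L m η (-(3 : ℝ)) (fun j (b : Site d × Fin d) => BondTouches (Ω j) b.1 b.2)
        (fun b => covLap η U₀ (fun z => restrictDom (Ω 0) A z b.2) b.1) :=
    B8ScaledSupNorm.weight_mul_norm_le_msup hbdr hj hb
  have h2 : weight L η (-(3 : ℝ)) j * ‖covLap η U₀ (fun z => outerPart (Ω 0) A z b.2) b.1‖ ≤ 4 * d * Φ := by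
    rcases Nat.eq_zero_or_pos j with rfl | hjpos
    · rw [e3, B8ScaledSupNorm.weight_neg_natCast, pow_zero, one_mul]
      calc η ^ 3 * ‖covLap η U₀ (fun z => outerPart (Ω 0) A z b.2) b.1‖ ≤ η ^ 3 * (4 * d * (η⁻¹ * (η⁻¹ * (η⁻¹ * Φ)))) :=
            mul_le_mul_of_nonneg_left (hLo b.2 b.1) (by positivity)
        _ = 4 * d * Φ := by field_simp
    · rw [covLap_outerPart_eq_zero hM η U₀ A hjpos hb, norm_zero, mul_zero]
      positivity
  rw [hsplit]
  calc weight L η (-(3 : ℝ)) j * ‖covLap η U₀ (fun z => restrictDom (Ω 0) A z b.2) b.1 +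
          covLap η U₀ (fun z => outerPart (Ω 0) A z b.2) b.1‖
      ≤ weight L η (-(3 : ℝ)) j * (‖covLap η U₀ (fun z => restrictDom (Ω 0) A z b.2) b.1‖ +
          ‖covLap η U₀ (fun z => outerPart (Ω 0) A z b.2) b.1‖) := mul_le_mul_of_nonneg_left (norm_add_le _ _) hw0
    _ ≤ _ := by rw [mul_add]; exact add_le_add h1 h2

end CollarEstimates

/-! ### §3.8 What does NOT see the outer part: the Landau condition, the averaging functional; the restricted datum is in E(Ω₀) -/

/-- **The Landau condition of record reads the bonds of `Ω₀` only**: `𝟙_{Ω₀}A` is Landau iff `A` is (`B8Eq138LandauZd.isLandau138_congr`).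
[cite: Balaban1985RegularSpaces, (1.38) p.82, p.77 (bond convention)] -/
theorem isLandau138_restrictDom_iff (L m : ℕ) (η : ℝ) (Ω₀ : Set (Site d)) (Λs : ℕ → Set (Site d)) (U₀ : Site d → Fin d → 𝔸ˣ)
    (A : Site d → Fin d → 𝔸) : IsLandau138 L m η Ω₀ Λs U₀ (restrictDom Ω₀ A) ↔ IsLandau138 L m η Ω₀ Λs U₀ A :=
  B8Eq138LandauZd.isLandau138_congr η L U₀ fun _ _ hb => restrictDom_of A hb

/-- **The averaging functional `|B₁|` reads the bonds of `Ω₀` only**: the linear parts `LʲηQ_j(U₀)A` at the averaging bonds `Λb m` are the same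
for `A` and `𝟙_{Ω₀}A`, because the block of an averaging bond lies in `Ω_j ⊆ Ω₀` (the member's `hbox` clause) and `Q_j` is local in the block
(`B9Ineq3137LocalSup.linCovIter_congr`, [3] p. 24 «this definition is local»). [cite: Balaban1985RegularSpaces, (1.56) p.86; Balaban1985Averaging, p.24] -/
theorem wsupB1_restrictDom {L : ℕ} (hL : 1 ≤ L) (m : ℕ) (η : ℝ) {Ω : ℕ → Set (Site d)} {Λb : ℕ → ℕ → Set (Site d × Fin d)}
    (hbox : ∀ j, j ≤ m → ∀ c ∈ Λb m j, ∀ x, InBox (loK L j c.1) (bondHiK L j c.1 c.2) x → x ∈ Ω 0)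
    (U₀ : Site d → Fin d → 𝔸ˣ) (A : Site d → Fin d → 𝔸) :
    wsup 1 (fun p : {p : ℕ × (Site d × Fin d) // p.1 ≤ m ∧ p.2 ∈ Λb m p.1} =>
        linCovIter L U₀ (iEta η (restrictDom (Ω 0) A)) p.1.1 p.1.2.1 p.1.2.2) =
      wsup 1 (fun p : {p : ℕ × (Site d × Fin d) // p.1 ≤ m ∧ p.2 ∈ Λb m p.1} =>
        linCovIter L U₀ (iEta η A) p.1.1 p.1.2.1 p.1.2.2) := by
  have h : (fun p : {p : ℕ × (Site d × Fin d) // p.1 ≤ m ∧ p.2 ∈ Λb m p.1} =>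
        linCovIter L U₀ (iEta η (restrictDom (Ω 0) A)) p.1.1 p.1.2.1 p.1.2.2) =
      fun p : {p : ℕ × (Site d × Fin d) // p.1 ≤ m ∧ p.2 ∈ Λb m p.1} => linCovIter L U₀ (iEta η A) p.1.1 p.1.2.1 p.1.2.2 := by
    funext p
    refine B9Ineq3137LocalSup.linCovIter_congr L hL p.1.1 p.1.2.1 p.1.2.2 (fun _ _ _ _ => rfl) fun x κ hx _ => ?_
    have hxΩ : x ∈ Ω 0 := hbox p.1.1 p.2.1 p.1.2 p.2.2 x hx
    simp only [iEta, restrictDom_of A (Or.inl hxΩ : BondTouches (Ω 0) x κ)]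
  rw [h]

/-- **THE RESTRICTED SOCKET DATUM IS A FIELD OF E(Ω₀)**: for `A′` with `‖A′(b)‖ ≤ α₂(Lʲη)⁻¹` on the sides of the plaquettes touching `Ω_j`, `j ≤ m`
((1.41)), the field `𝟙_{Ω₀}A′` vanishes off the bonds of `Ω₀` and its weighted family is bounded by `α₂`.
[cite: Balaban1985RegularSpaces, (1.41) p.83, p.77 (bond convention); Balaban1985BackgroundPropagators, (3.27) p.395] -/
theorem onDom_restrictDom {L m : ℕ} (hL : 1 ≤ L) {η : ℝ} (hη : 0 < η) {Ω : ℕ → Set (Site d)} {A : Site d → Fin d → 𝔸} {α₂ : ℝ}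
    (h41 : ∀ j, j ≤ m → ∀ (y : Site d) (τ : Fin d), SideTouches (Ω j) y τ → ‖A y τ‖ ≤ α₂ * ((L : ℝ) ^ j * η)⁻¹) :
    OnDom L m η Ω (restrictDom (Ω 0) A) := by
  refine ⟨fun y τ h => restrictDom_of_not A h, ?_⟩
  have e1 : (-(1 : ℝ)) = -((1 : ℕ) : ℝ) := by norm_num
  rw [e1]
  refine B8ScaledSupNorm.bdd_of_forall (c := α₂) fun j hj b hb => ?_
  rw [B8ScaledSupNorm.weight_neg_natCast, pow_one]
  have hs : 0 < (L : ℝ) ^ j * η := B8ScaledSupNorm.scale_pos hL hη j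
  calc (L : ℝ) ^ j * η * ‖restrictDom (Ω 0) A b.1 b.2‖ ≤ (L : ℝ) ^ j * η * ‖A b.1 b.2‖ :=
        mul_le_mul_of_nonneg_left (norm_restrictDom_le _ A _ _) hs.le
    _ ≤ (L : ℝ) ^ j * η * (α₂ * ((L : ℝ) ^ j * η)⁻¹) := mul_le_mul_of_nonneg_left (h41 j hj b.1 b.2 hb) hs.le
    _ = α₂ := by rw [mul_comm α₂, ← mul_assoc, mul_inv_cancel₀ hs.ne', one_mul]

/-- On the bonds of `Ω₀` the restricted field keeps the (1.41) bounds of the datum: `‖𝟙_{Ω₀}A′(b)‖ ≤ α₂(Lʲη)⁻¹` on the sides of the plaquettes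
touching `Ω_j`. [cite: Balaban1985RegularSpaces, (1.41) p.83] -/
theorem restrictDom_bound_of_bound {L m : ℕ} {η : ℝ} {Ω : ℕ → Set (Site d)} {A : Site d → Fin d → 𝔸} {α₂ : ℝ} (hα₂ : 0 ≤ α₂) (hη : 0 ≤ η)
    (h41 : ∀ j, j ≤ m → ∀ (y : Site d) (τ : Fin d), SideTouches (Ω j) y τ → ‖A y τ‖ ≤ α₂ * ((L : ℝ) ^ j * η)⁻¹) :
    ∀ j, j ≤ m → ∀ (y : Site d) (τ : Fin d), SideTouches (Ω j) y τ → ‖restrictDom (Ω 0) A y τ‖ ≤ α₂ * ((L : ℝ) ^ j * η)⁻¹ := by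
  intro j hj y τ hs
  by_cases hb : BondTouches (Ω 0) y τ
  · rw [restrictDom_of A hb]; exact h41 j hj y τ hs
  · rw [restrictDom_of_not A hb, norm_zero]; positivity

end Calculus

/-! ## §4 The margin predicate at the cube families of (1.131) and at `Ω₀ = ℤᵈ` -/

section Margins

/-- **THE CUBE FAMILY `{□_j}_{j=0}^{k}` OF (1.131)∕(1.132) HAS `Margin2`** when `R₁M₁ ≥ 2`: the margins of p. 98 satisfy `m₀ = m₁ + R₁M₁` and
`m_j ≤ m₁` for `1 ≤ j ≤ k` (`B8Eq131Cubes.margin_succ`∕`margin_anti`), so the ℓ∞-`2`-neighbourhood of `□_j` lies in `□₀`.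
[cite: Balaban1985RegularSpaces, p.98 («a distance between boundaries of these cubes is equal to R₁M₁Lʲη»), (1.131)–(1.132) p.99] -/
theorem margin2_cubeFam (L : ℕ) (a : Site d) (M : ℕ) {ρ : ℕ} (hρ : 2 ≤ ρ) (k : ℕ) : Margin2 (cubeFam false L a M ρ k) := by
  intro j hj v hv y hy
  by_cases hjk : j ≤ k
  · rw [B8Eq131CubesAdmissible.cubeFam_false_of_le L a M ρ hjk, B8Eq131Cubes.cube_eq hjk] at hv
    rw [B8Eq131CubesAdmissible.cubeFam_false_zero, B8Eq131Cubes.cube_eq (Nat.zero_le k)]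
    have hk : 0 < k := by omega
    -- m₀ = m₁ + ρ and m_j ≤ m₁
    have h01 : L ^ 0 * (ρ * B8Eq131Cubes.gs L (k - 0)) = L ^ (0 + 1) * (ρ * B8Eq131Cubes.gs L (k - (0 + 1))) + ρ * L ^ 0 :=
      B8Eq131Cubes.margin_succ hk
    have hj1 : L ^ j * (ρ * B8Eq131Cubes.gs L (k - j)) ≤ L ^ 1 * (ρ * B8Eq131Cubes.gs L (k - 1)) :=
      B8Eq131Cubes.margin_anti L ρ k 1 j hj hjk
    have hm : (L ^ j * (ρ * B8Eq131Cubes.gs L (k - j)) : ℤ) + 2 ≤ (L ^ 0 * (ρ * B8Eq131Cubes.gs L (k - 0)) : ℕ) := by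
      rw [h01]
      simp only [zero_add, pow_zero, mul_one] at hj1 ⊢
      push_cast
      have := (Nat.cast_le (α := ℤ)).mpr hj1
      push_cast at this
      have hρ' : (2 : ℤ) ≤ ρ := by exact_mod_cast hρ
      linarith
    intro i
    obtain ⟨h1, h2⟩ := hv i
    obtain ⟨h3, h4⟩ := hy i
    simp only [B8Eq131Cubes.bLo, B8Eq131Cubes.bHi] at h1 h2 ⊢
    push_cast at h1 h2 hm ⊢
    constructor <;> linarith
  · rw [B8Eq131CubesAdmissible.cubeFam_of_lt false L a M ρ (by omega)] at hv
    exact absurd hv (Set.notMem_empty v)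

/-- A family with `Ω₀ = ℤᵈ` has `Margin2` trivially. [cite: Balaban1985RegularSpaces, p.77 («some domains Ω_j are equal to T_η»)] -/
theorem margin2_of_univ {Ω : ℕ → Set (Site d)} (h : Ω 0 = Set.univ) : Margin2 Ω := by
  intro j _ v _ y _
  rw [h]
  exact Set.mem_univ y

/-- The domain sequence of a `ZdIdx` datum decreases: `Ω_{j′} ⊆ Ω_j` for `j ≤ j′` ((1.3) «Ω₀ ⊃ Ω₁ ⊃ … ⊃ Ω_k»).
[cite: Balaban1985RegularSpaces, (1.3) p.77] -/
theorem omega_subset_of_le {L : ℕ} (i : ZdIdx d L) {j j' : ℕ} (h : j ≤ j') : i.Ω j' ⊆ i.Ω j := by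
  induction h with
  | refl => exact le_rfl
  | step _ ih => exact (i.hΩ _).trans ih

/-- The block of an averaging bond of a `ZdIdx` datum lies in `Ω₀` (the member's `hbox` clause and `Ω_j ⊆ Ω₀`) — the hypothesis of
`wsupB1_restrictDom` at the member. [cite: Balaban1985RegularSpaces, (1.3)–(1.5) p.77, (1.56) p.86] -/
theorem hbox_zero {L : ℕ} (i : ZdIdx d L) {m : ℕ} (hm : m ≤ i.k) :
    ∀ j, j ≤ m → ∀ c ∈ i.Λb m j, ∀ x, InBox (loK L j c.1) (bondHiK L j c.1 c.2) x → x ∈ i.Ω 0 :=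
  fun j hj c hc x hx => omega_subset_of_le i (Nat.zero_le j) (i.hbox m hm j hj c hc x hx)

end Margins

/-! ## §5 The four-line collar socket (the suppliable part of dag-n05-e's repaired Prop.-3-frame socket) -/

section Socket

variable {𝔸 : Type*} [CStarAlgebra 𝔸]

open B8Lemma1NonAbelian (mulCfg)
open B8Eq138LandauZd (IsLandau138W)
open B8Eq184Proof (cfgExp)

/-- **THE FOUR-LINE COLLAR SOCKET** `SockB9P3D4`: lines 1–4 of [4] Theorem 3.3 for `G(U₀)` read through B8 (1.57)–(1.59) IN THE REPAIRED CURRENCY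
of dag-n05-e's located repair R-d — the datum and guard of n05-a's `B8LeafModelZd3.SockB9P3` VERBATIM (unitary `U₀`, `W` with (1.40), the Landau
condition of record for `W`, a Hermitian exponent field `A′` with `W = e^{iηA′}`, `|A′| ≤ α₂(Lʲη)⁻¹` on the sides of the plaquettes touching `Ω_j`,
`A′ = 0` off them), and the conclusions `|A′|₍₋₁₎, |∇^η_{U₀}A′|₍₋₂₎, |D^{η*}D^ηA′|₍₋₃₎, |Δ^η_{U₀}A′|₍₋₃₎ ≤ B₀(|J|₍₋₃₎ + |B₁|) + B_∂·Φ₀(A′)` with the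
level-0 collar functional `Φ₀(A′) = sup_{b ∈ SideTouches(Ω₀) ∖ BondTouches(Ω₀)} η‖A′(b)‖` — EXACTLY lines 1–4 of the inline sockets of
`B8Prop6CubeMemberNormsBdry.norms136_cubeMember_at_bdry` ∕ `B8Prop6CubeMemberGaugedBdry.prop6Printed_zdCub_bdry₅` (their 5th, Hölder, line with the
same level-0 collar weight is not suppliable uniformly in `k`: an admissible pair `(x ∈ Ω_{k−1}, x′` at the collar`)` reads the collar gradient `t∕η` with
weight `(L^{k−1}η)^{2+β}`; the Hölder line stays print-exact — Ω₀-supported data — in the companion file).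
[cite: Balaban1985RegularSpaces, (1.57)–(1.59) p.86, (1.40)–(1.42) p.83, (1.133) p.99; Balaban1985BackgroundPropagators, Thm 3.3 p.399, (3.47) p.398] -/
def SockB9P3D4 (L : ℕ) (B₀ Bbd cP : ℝ) (η : ℝ) (k : ℕ) (Ω : ℕ → Set (Site d)) (Λs : ℕ → ℕ → Set (Site d))
    (Λb : ℕ → ℕ → Set (Site d × Fin d)) : Prop :=
  ∀ α₀ α₂ : ℝ, 0 < α₀ → α₀ ≤ cP → 0 < α₂ → α₂ ≤ cP →
    ∀ (U₀ W : Site d → Fin d → 𝔸ˣ), (∀ x κ, U₀ x κ ∈ unitaryUnits 𝔸) → (∀ x κ, W x κ ∈ unitaryUnits 𝔸) →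
    InAk L k η α₀ Ω U₀ → InAk L k η α₀ Ω (mulCfg W U₀) → IsLandau138W L k η (Ω 0) (Λs k) U₀ W →
    ∀ A' : Site d → Fin d → 𝔸, (∀ y τ, IsSelfAdjoint (A' y τ)) →
    (∀ j, j ≤ k → ∀ (y : Site d) (τ : Fin d), SideTouches (Ω j) y τ →
      W y τ = cfgExp η A' y τ ∧ ‖A' y τ‖ ≤ α₂ * ((L : ℝ) ^ j * η)⁻¹) →
    (∀ (y : Site d) (τ : Fin d), (∀ j, j ≤ k → ¬ SideTouches (Ω j) y τ) → A' y τ = 0) →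
    msup L k η (-(1 : ℝ)) (fun j (b : Site d × Fin d) => SideTouches (Ω j) b.1 b.2) (fun b => A' b.1 b.2)
        ≤ B₀ * (bondNorm L k η (-(3 : ℝ)) Ω (fun x μ => Jcur η U₀ A' μ x)
          + wsup 1 (fun p : {p : ℕ × (Site d × Fin d) // p.1 ≤ k ∧ p.2 ∈ Λb k p.1} =>
              linCovIter L U₀ (iEta η A') p.1.1 p.1.2.1 p.1.2.2))
          + Bbd * msup L k η (-(1 : ℝ)) (fun j (b : Site d × Fin d) => j = 0 ∧ SideTouches (Ω 0) b.1 b.2 ∧ ¬ BondTouches (Ω 0) b.1 b.2)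
              (fun b => A' b.1 b.2) ∧
      msup L k η (-(2 : ℝ)) (fun j (t : Fin d × Fin d × Site d) => SideTouches (Ω j) t.2.2 t.2.1)
          (fun t => covDerivFwd η U₀ t.1 (fun z => A' z t.2.1) t.2.2)
        ≤ B₀ * (bondNorm L k η (-(3 : ℝ)) Ω (fun x μ => Jcur η U₀ A' μ x)
          + wsup 1 (fun p : {p : ℕ × (Site d × Fin d) // p.1 ≤ k ∧ p.2 ∈ Λb k p.1} =>
              linCovIter L U₀ (iEta η A') p.1.1 p.1.2.1 p.1.2.2))
          + Bbd * msup L k η (-(1 : ℝ)) (fun j (b : Site d × Fin d) => j = 0 ∧ SideTouches (Ω 0) b.1 b.2 ∧ ¬ BondTouches (Ω 0) b.1 b.2)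
              (fun b => A' b.1 b.2) ∧
      bondNorm L k η (-(3 : ℝ)) Ω (fun x μ => pdiv η U₀ (plaqCovDeriv η U₀ A') μ x)
        ≤ B₀ * (bondNorm L k η (-(3 : ℝ)) Ω (fun x μ => Jcur η U₀ A' μ x)
          + wsup 1 (fun p : {p : ℕ × (Site d × Fin d) // p.1 ≤ k ∧ p.2 ∈ Λb k p.1} =>
              linCovIter L U₀ (iEta η A') p.1.1 p.1.2.1 p.1.2.2))
          + Bbd * msup L k η (-(1 : ℝ)) (fun j (b : Site d × Fin d) => j = 0 ∧ SideTouches (Ω 0) b.1 b.2 ∧ ¬ BondTouches (Ω 0) b.1 b.2)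
              (fun b => A' b.1 b.2) ∧
      bondNorm L k η (-(3 : ℝ)) Ω (fun x μ => covLap η U₀ (fun z => A' z μ) x)
        ≤ B₀ * (bondNorm L k η (-(3 : ℝ)) Ω (fun x μ => Jcur η U₀ A' μ x)
          + wsup 1 (fun p : {p : ℕ × (Site d × Fin d) // p.1 ≤ k ∧ p.2 ∈ Λb k p.1} =>
              linCovIter L U₀ (iEta η A') p.1.1 p.1.2.1 p.1.2.2))
          + Bbd * msup L k η (-(1 : ℝ)) (fun j (b : Site d × Fin d) => j = 0 ∧ SideTouches (Ω 0) b.1 b.2 ∧ ¬ BondTouches (Ω 0) b.1 b.2)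
              (fun b => A' b.1 b.2)

/-- `SockB9P3D4` is antitone in the threshold `cP`. [cite: Balaban1985RegularSpaces, (1.59) p.86] -/
theorem sockB9P3D4_anti {L : ℕ} {B₀ Bbd cP cP' : ℝ} (h : cP' ≤ cP) {η : ℝ} {k : ℕ} {Ω : ℕ → Set (Site d)} {Λs : ℕ → ℕ → Set (Site d)}
    {Λb : ℕ → ℕ → Set (Site d × Fin d)} (S : SockB9P3D4 (𝔸 := 𝔸) L B₀ Bbd cP η k Ω Λs Λb) :
    SockB9P3D4 (𝔸 := 𝔸) L B₀ Bbd cP' η k Ω Λs Λb :=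
  fun α₀ α₂ hα₀ hα₀c hα₂ hα₂c => S α₀ α₂ hα₀ (hα₀c.trans h) hα₂ (hα₂c.trans h)

end Socket

end Literature.MathematicalPhysics.QuantumFieldTheory.Balaban1983to89.B9SupplySockB9P3ZdLettersOmega

end
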